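import Summits.QuantumFields.YangMills.Theorems.FlatTubeReductionOneSiteQuasimodeCore
import Summits.QuantumFields.YangMills.Theorems.LuscherReductionDressedRitzPolyakovLiftPScalingLevels
import Summits.QuantumFields.YangMills.Theorems.FemtoCutoffLadderFixedLatticeLawInnerRateCopies
import HarnessLib

/-!
# ★★ A CONCENTRATED rate-grade one-site quasimode in ONE twist copy (rate-twin input of the FLOOR WITH RATE of `stub_boRate`;
# route `FlatTubeReduction`, crux K1 `NearFlatRatioLaw` stmt-QuantumFields-24720; seat `ym-line-ftr-p1` g9; part 4 of 4)

WHY.  The Born–Oppenheimer door with rate (`Cruxes/NearFlatRatioLaw/Lines/borate.lean`, = FCL 23943's `BORateAll`) has the clause FLOOR WITH RATE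
`N·μ₀(L³β)·e^{−C·λ_b(L³β)²} ≤ λ₀(β,L)`.  Its trial state is a fibred product `f(u)·Ω_u(v)` on the tube chart; the frozen fibre energy `λ(u) = λ(1)·e^{−V(u)}`,
`V ≍ κ‖c(u)‖²` (stiff zero-point shift + Faddeev–Popov ratio), is CARRIED with its sign on the upper side (toolkit `borate-rate-toolkit-g7.md`) but enters the floor through
`∫(1 − e^{−V})f²`, which is `O(λ_b²)‖f‖²` only if the one-site amplitude `f` is CONCENTRATED at the slow scale `‖c‖ ≍ λ_b` in second moment.  An IMS near-maximiser
(lane A's first-order `exists_localized_near_top`, radius `13B^{-1/5}`) gives neither the rate nor the concentration; crux ONE's Gaussian-window trial state with a SHRINKING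
cut-off does.  Results (ns `…FemtoTransferGap.Quasimode`; `E₁ = physLevel 1`, `λ_b = bareLambda B`, `μ₀ = levelValue su2Rep 1 B 0`):
* ★★ `exists_concentrated_quasimode` — `∃ C ≥ 0, B₀, ∀ B ≥ B₀, ∃ φ` bounded measurable GAUGE-INVARIANT, supported in the all-upper hemisphere pattern ∩
  `{orbitDist < √λ_b}` (one twist copy of the vacuum, radius `≍ B^{-1/6}`), `‖φ‖² > 0`, RATE-GRADE `linkC(B)³e^{−E₁λ_b − Cλ_b²}‖φ‖² ≤ ⟨φ,K_Bφ⟩`, and CONCENTRATED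
  `∫‖zmCoord 1 U‖²φ(U)²dU ≤ Cλ_b²‖φ‖²`;
* ★★ `exists_concentrated_quasimode_levelValue` — the same with `e^{−Cλ_b²}·μ₀(B)·‖φ‖² ≤ ⟨φ,K_Bφ⟩` (crux ONE's absolute upper bound `PScal.oneSiteAbsUpper_holds 0`);
* bookkeeping: `cutoff_facts` / `exp_neg_cutoff_le` (`R = 1/(16√μ)`: `1 ≤ R ≤ 1/(8μ)`, `μR = √μ/16`, `e^{−R} ≤ 3072μ³` eventually), `one_copy_props`, `scale_facts`
  (the chart scale `μ = λ_b/2` and its smallness, as in `oneSiteAbsLower_of_eigenfunctions`), `support_radius_lt` (`6√6·μR < √λ_b`), `rayleigh_algebra`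
  (absorption of the seven cross-copy terms `7·crossBound ≤ ½e^{−E₁λ_b−C₀λ_b²}λ_b²·linkC³`, from `crossBound_eventually_small_sq`, into one extra `λ_b²`).
`|φ|` has the same properties (positive kernel); the rate-twin seat takes `φ` (or `|φ|`) as the slow profile of the floor's trial state.
HONEST FRAMING: a one-site (finite-dimensional) computation over crux ONE's landed analysis; an input of the RATE twin of RED lane A's C4-CORE for the femto rung
R2b1 (RECORD label) — route `FlatTubeReduction`, crux K1 `NearFlatRatioLaw` stmt-QuantumFields-24720 / FCL `FixedLatticeLaw` 23943; not infinite volume, not a mass gap,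
not Clay.  No new definitions, no named facts, no `sorry`.
-/

set_option autoImplicit false

noncomputable section

open MeasureTheory Filter Topology Real
open scoped Matrix ENNReal BigOperators
open Literature.MathematicalPhysics.QuantumFieldTheory
open Literature.MathematicalPhysics.QuantumLattice
open Literature.Analysis.OperatorTheory.YMMatrixModel

namespace Summit.QuantumFields.YangMills.Theorems.FemtoTransferGap

namespace Quasimode

open Summit.QuantumFields.YangMills.Theorems.FemtoCutoffLadder

/-! ## §5 ★★ The concentrated rate-grade quasimode -/

/-- The cut-off radius `R = 1/(16√μ)`: `1 ≤ R ≤ 1/(8μ)` for `0 < μ ≤ 1/256`, and `μR = √μ/16`. [folklore] -/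
theorem cutoff_facts {μ : ℝ} (hμ : 0 < μ) (hμ256 : μ ≤ 1 / 256) :
    1 ≤ 1 / (16 * Real.sqrt μ) ∧ 1 / (16 * Real.sqrt μ) ≤ 1 / (8 * μ) ∧ μ * (1 / (16 * Real.sqrt μ)) = Real.sqrt μ / 16 := by
  have hs0 : 0 < Real.sqrt μ := Real.sqrt_pos.2 hμ
  have hsq : Real.sqrt μ ^ 2 = μ := Real.sq_sqrt hμ.le
  have hs16 : Real.sqrt μ ≤ 1 / 16 := by
    rw [show (1:ℝ) / 16 = Real.sqrt ((1/16) ^ 2) by rw [Real.sqrt_sq (by norm_num)]]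
    exact Real.sqrt_le_sqrt (by norm_num; linarith)
  refine ⟨?_, ?_, ?_⟩
  · rw [le_div_iff₀ (by positivity)]; linarith
  · rw [div_le_div_iff₀ (by positivity) (by positivity)]
    nlinarith
  · field_simp
    nlinarith

/-- The threshold for the tail of the cut-off: `x⁶ e^{−x} ≤ 3/16384` for `x ≥ x₀`, read at `x = 1/(16√μ) ≥ max x₀ 1`, gives `e^{−R} ≤ 3072μ³`. [folklore] -/
theorem exp_neg_cutoff_le {x₀ : ℝ} (hx₀ : ∀ x : ℝ, x₀ ≤ x → x ^ 6 * Real.exp (-(1 * x)) ≤ 3 / 16384) {μ : ℝ} (hμ : 0 < μ)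
    (hμx : Real.sqrt μ ≤ 1 / (16 * (max x₀ 1))) :
    Real.exp (-(1 / (16 * Real.sqrt μ))) ≤ 3072 * μ ^ 3 := by
  have hs0 : 0 < Real.sqrt μ := Real.sqrt_pos.2 hμ
  have hsq : Real.sqrt μ ^ 2 = μ := Real.sq_sqrt hμ.le
  have hm1 : 1 ≤ max x₀ 1 := le_max_right _ _
  set x : ℝ := 1 / (16 * Real.sqrt μ) with hx
  have hx0 : 0 < x := by positivity
  have hxge : max x₀ 1 ≤ x := by
    rw [hx, le_div_iff₀ (by positivity)]
    have := mul_le_mul_of_nonneg_left hμx (by positivity : (0:ℝ) ≤ 16 * max x₀ 1)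
    rw [show 16 * max x₀ 1 * (1 / (16 * max x₀ 1)) = 1 by field_simp] at this
    linarith
  have h := hx₀ x ((le_max_left _ _).trans hxge)
  rw [one_mul] at h
  -- `μ = 1/(256 x²)` so `3072 μ³ = 3/(16384 x⁶)`
  have hμx2 : μ = 1 / (256 * x ^ 2) := by
    rw [hx]; field_simp; nlinarith [hsq]
  have hx6 : 0 < x ^ 6 := by positivity
  rw [hμx2]
  rw [show (3072 : ℝ) * (1 / (256 * x ^ 2)) ^ 3 = (3 / 16384) / x ^ 6 by field_simp; ring]
  rw [le_div_iff₀ hx6, mul_comm]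
  exact h

/-- Bookkeeping for the one-copy restriction `φ = 𝟙_+ · (G ∘ gnCoord μ)` of the pull-back of a bounded measurable colour-invariant `G`: measurable, bounded,
gauge invariant, and `φ U ≠ 0 ⇒ U` all-upper with `G (gnCoord μ U) ≠ 0`. [folklore] -/
theorem one_copy_props {G : ZM → ℝ} (hGm : Measurable G) (hGb : ∃ C : ℝ, ∀ x, |G x| ≤ C) (hGinv : IsGaugeInv G) (μ : ℝ) :
    Measurable (Set.indicator {V : Cfg | ∀ e : Edge 3 1, 0 < scalarPart (V e)} (fun U : Cfg => G (gnCoord μ U))) ∧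
    (∃ C : ℝ, ∀ U, |Set.indicator {V : Cfg | ∀ e : Edge 3 1, 0 < scalarPart (V e)} (fun U : Cfg => G (gnCoord μ U)) U| ≤ C) ∧
    (∀ (g : Site 3 1 → SU2) (U : Cfg), Set.indicator {V : Cfg | ∀ e : Edge 3 1, 0 < scalarPart (V e)} (fun U : Cfg => G (gnCoord μ U)) (gaugeTransform g U) =
      Set.indicator {V : Cfg | ∀ e : Edge 3 1, 0 < scalarPart (V e)} (fun U : Cfg => G (gnCoord μ U)) U) ∧
    (∀ U, Set.indicator {V : Cfg | ∀ e : Edge 3 1, 0 < scalarPart (V e)} (fun U : Cfg => G (gnCoord μ U)) U ≠ 0 →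
      (∀ e : Edge 3 1, 0 < scalarPart (U e)) ∧ G (gnCoord μ U) ≠ 0) := by
  have hΨ : IsPhys (fun U : Cfg => G (gnCoord μ U)) := isPhys_gnPullback hGm hGb hGinv μ
  obtain ⟨C, hC⟩ := hGb
  refine ⟨hΨ.measurable.indicator measurableSet_upper, ⟨C, fun U => ?_⟩, fun g U => ?_, fun U hU => ?_⟩
  · rw [Set.indicator_apply]
    split_ifs
    · exact hC _
    · rw [abs_zero]; exact (abs_nonneg _).trans (hC 0)
  · have hmem : (gaugeTransform g U ∈ {V : Cfg | ∀ e : Edge 3 1, 0 < scalarPart (V e)}) ↔ (U ∈ {V : Cfg | ∀ e : Edge 3 1, 0 < scalarPart (V e)}) := by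
      simp only [Set.mem_setOf_eq, gaugeTransform_one_site_eq, scalarPart_conj]
    by_cases h : U ∈ {V : Cfg | ∀ e : Edge 3 1, 0 < scalarPart (V e)}
    · rw [Set.indicator_of_mem (hmem.2 h), Set.indicator_of_mem h]
      exact hΨ.gaugeInv g U
    · rw [Set.indicator_of_notMem (fun h' => h (hmem.1 h')), Set.indicator_of_notMem h]
  · by_cases hmem : U ∈ {V : Cfg | ∀ e : Edge 3 1, 0 < scalarPart (V e)}
    · rw [Set.indicator_of_mem hmem] at hU
      exact ⟨hmem, hU⟩
    · exact absurd (Set.indicator_of_notMem hmem _) hU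

/-- The chart scale `μ = λ_b(B)/2` and its smallness conditions, from a threshold on `B` (bookkeeping of crux ONE's `oneSiteAbsLower_of_eigenfunctions`,
plus the cut-off conditions of this file). [folklore] -/
theorem scale_facts {A E K x₀ μ0 : ℝ} (hA0 : 0 ≤ A) (hE0 : 0 ≤ E) (hK0 : 0 ≤ K) (hμ0pos : 0 < μ0) (hμ0a : μ0 ≤ 1 / 256)
    (hμ0b : μ0 ≤ (1 / (2 * (A * ((0:ℕ) + 1) * 3072 + 1))) ^ ((1:ℝ) / 3)) (hμ0c : μ0 ≤ (1 / (4 * π)) ^ ((1:ℝ) / 3))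
    (hμ0d : μ0 ≤ 1 / (4 * (2 * E + K + 1))) (hμ0e : μ0 ≤ (1 / (16 * max x₀ 1)) ^ 2)
    {B : ℝ} (hBge1 : 2 / (2 * μ0) ^ 3 ≤ B) (hB2 : 2 ≤ B) :
    ∃ μ : ℝ, bareLambda B = 2 * μ ∧ 0 < μ ∧ μ ≤ μ0 ∧ B * μ ^ 3 = 1 / 4 ∧ μ ≤ 1 / 256 ∧
      A * ((0:ℕ) + 1) * (3072 * μ ^ 3) ≤ 1 / 2 ∧ π ≤ B ∧ 2 * μ * E + μ ^ 2 * K ≤ 1 / 2 ∧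
      Real.sqrt μ ≤ 1 / (16 * max x₀ 1) ∧ bareLambda B ≤ 1 ∧ 0 < bareLambda B := by
  have hB : 0 < B := by linarith
  have hlam0 : 0 < bareLambda B := bareLambda_pos' hB
  have hlamle : bareLambda B ≤ 2 * μ0 := bareLambda_le_of_le (by positivity) hBge1
  have hlam1 : bareLambda B ≤ 1 := by
    unfold bareLambda
    exact Real.rpow_le_one (by positivity) ((div_le_one hB).2 hB2) (by norm_num)
  have hth1 : 0 < (1 / (2 * (A * ((0:ℕ) + 1) * 3072 + 1))) := by positivity
  have hth2 : 0 < 1 / (4 * π) := by positivity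
  refine ⟨bareLambda B / 2, by ring, by linarith, by linarith, ?_, by linarith, ?_, ?_, ?_, ?_, hlam1, hlam0⟩
  · have := bareLambda_half_cube hB; exact this
  · set μ := bareLambda B / 2 with hμdef
    have hμ : 0 < μ := by rw [hμdef]; linarith
    have hμle : μ ≤ μ0 := by rw [hμdef]; linarith
    have h2 := pow_three_le_of_le_rpow_third hμ.le hth1.le (hμle.trans hμ0b)
    have h3 : A * ((0:ℕ) + 1) * 3072 * μ ^ 3 ≤ A * ((0:ℕ) + 1) * 3072 * (1 / (2 * (A * ((0:ℕ) + 1) * 3072 + 1))) :=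
      mul_le_mul_of_nonneg_left h2 (by positivity)
    have h4 : A * ((0:ℕ) + 1) * 3072 * (1 / (2 * (A * ((0:ℕ) + 1) * 3072 + 1))) ≤ 1 / 2 := by
      rw [mul_one_div, div_le_iff₀ (by positivity)]
      have : (0:ℝ) ≤ A * ((0:ℕ) + 1) * 3072 := by positivity
      nlinarith
    nlinarith
  · set μ := bareLambda B / 2 with hμdef
    have hμ : 0 < μ := by rw [hμdef]; linarith
    have hμle : μ ≤ μ0 := by rw [hμdef]; linarith
    have hBμ : B * μ ^ 3 = 1 / 4 := bareLambda_half_cube hB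
    have h2 := pow_three_le_of_le_rpow_third hμ.le hth2.le (hμle.trans hμ0c)
    have h3 : B = 1 / (4 * μ ^ 3) := by field_simp; nlinarith [hBμ]
    rw [h3, le_div_iff₀ (by positivity)]
    have := mul_le_mul_of_nonneg_left h2 (by positivity : (0:ℝ) ≤ 4 * π)
    rw [mul_one_div, div_self (by positivity)] at this
    nlinarith [Real.pi_pos]
  · set μ := bareLambda B / 2 with hμdef
    have hμ : 0 < μ := by rw [hμdef]; linarith
    have hμle : μ ≤ μ0 := by rw [hμdef]; linarith
    have h1 : μ ≤ 1 / (4 * (2 * E + K + 1)) := hμle.trans hμ0d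
    have h2 : μ * (2 * E + K + 1) ≤ 1 / 4 := by rw [le_div_iff₀ (by positivity)] at h1; linarith
    nlinarith [mul_nonneg hμ.le hK0, sq_nonneg μ]
  · have hX1 : 0 < max x₀ 1 := lt_of_lt_of_le one_pos (le_max_right _ _)
    have hμle : bareLambda B / 2 ≤ μ0 := by linarith
    have := Real.sqrt_le_sqrt (hμle.trans hμ0e)
    rwa [Real.sqrt_sq (by positivity)] at this

/-- The support radius: with `μR = √μ/16`, `6√3·μ·(√2 R) < √(2μ)` (`= √λ_b`). [folklore] -/
theorem support_radius_lt {μ R : ℝ} (hμ : 0 < μ) (hμR : μ * R = Real.sqrt μ / 16) :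
    6 * Real.sqrt 3 * μ * (Real.sqrt 2 * R) < Real.sqrt (2 * μ) := by
  have hs3 : Real.sqrt 3 < 8 / 3 := by
    rw [show (8:ℝ) / 3 = Real.sqrt ((8/3) ^ 2) by rw [Real.sqrt_sq (by norm_num)]]
    exact Real.sqrt_lt_sqrt (by norm_num) (by norm_num)
  have hsq : Real.sqrt (2 * μ) = Real.sqrt 2 * Real.sqrt μ := Real.sqrt_mul (by norm_num) μ
  have hpos : 0 < Real.sqrt 2 * Real.sqrt μ := mul_pos (Real.sqrt_pos.2 (by norm_num)) (Real.sqrt_pos.2 hμ)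
  have e : 6 * Real.sqrt 3 * μ * (Real.sqrt 2 * R) = (3 / 8) * Real.sqrt 3 * (Real.sqrt 2 * Real.sqrt μ) := by
    rw [show 6 * Real.sqrt 3 * μ * (Real.sqrt 2 * R) = 6 * Real.sqrt 3 * Real.sqrt 2 * (μ * R) by ring, hμR]; ring
  rw [hsq, e]
  have : (3 / 8) * Real.sqrt 3 * (Real.sqrt 2 * Real.sqrt μ) < 1 * (Real.sqrt 2 * Real.sqrt μ) :=
    mul_lt_mul_of_pos_right (by linarith) hpos
  linarith

/-- The pure-real endgame of the Rayleigh bound: from `L3(1−t)n ≤ Q + 7cB·n`, `ea ≤ 1−t`, `7cB ≤ ½·ea·λ²·L3`, `eb ≤ 1 − λ²/2`, `ec ≤ ea·eb` conclude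
`L3·ec·n ≤ Q`. [folklore] -/
theorem rayleigh_algebra {L3 n Q t ea eb ec lam cB : ℝ} (hL3 : 0 ≤ L3) (hn : 0 ≤ n) (hea0 : 0 ≤ ea)
    (hray : L3 * (1 - t) * n ≤ Q + 7 * cB * n) (hexp : ea ≤ 1 - t) (hcb : 7 * cB ≤ (1 / 2) * ea * lam ^ 2 * L3)
    (hhalf : eb ≤ 1 - lam ^ 2 / 2) (hCexp : ec ≤ ea * eb) : L3 * ec * n ≤ Q := by
  have h1 : L3 * ea * n ≤ L3 * (1 - t) * n := mul_le_mul_of_nonneg_right (mul_le_mul_of_nonneg_left hexp hL3) hn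
  have h2 : 7 * cB * n ≤ (1 / 2) * ea * lam ^ 2 * L3 * n := mul_le_mul_of_nonneg_right hcb hn
  have h3 : L3 * ea * (1 - lam ^ 2 / 2) * n ≤ Q := by nlinarith [h1, h2, hray]
  have h4 : L3 * ec * n ≤ L3 * (ea * eb) * n := mul_le_mul_of_nonneg_right (mul_le_mul_of_nonneg_left hCexp hL3) hn
  have h5 : L3 * (ea * eb) * n ≤ L3 * ea * (1 - lam ^ 2 / 2) * n := by
    have := mul_le_mul_of_nonneg_left hhalf hea0
    have := mul_le_mul_of_nonneg_right (mul_le_mul_of_nonneg_left this hL3) hn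
    nlinarith [this]
  linarith

/-- ★★ **A CONCENTRATED RATE-GRADE ONE-SITE QUASIMODE IN ONE TWIST COPY.**  There are `C ≥ 0` and `B₀` such that for every `B ≥ B₀` there is a
bounded measurable gauge-invariant one-site function `φ`, supported in the all-upper hemisphere pattern intersected with `{orbitDist < √λ_b(B)}`
(ONE twist copy of the vacuum, radius `≍ B^{-1/6}`), with `‖φ‖² > 0`, the RATE-GRADE quasimode bound `linkC(B)³·e^{−E₁λ_b − Cλ_b²}·‖φ‖² ≤ ⟨φ, K_B φ⟩`
(`E₁ = physLevel 1`, `λ_b = bareLambda B`), and the SECOND-MOMENT CONCENTRATION at the slow scale `∫ ‖zmCoord 1 U‖²·φ(U)² dU ≤ C·λ_b²·‖φ‖²`.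
(`φ` is the one-copy restriction of crux ONE's trial state `(χ_R f₀) ∘ gnCoord (λ_b/2)` with cut-off `R = 1/(16√μ)`; `|φ|` has the same properties, the kernel
being positive.)  Rate-twin input of the FLOOR WITH RATE of `stub_boRate` (K1 24720 / FCL 23943). [cite: Luscher1983, §2] [cite: ReedSimonIV1978, Thm. XIII.1–2] -/
theorem exists_concentrated_quasimode :
    ∃ C B₀ : ℝ, 0 ≤ C ∧ ∀ B : ℝ, B₀ ≤ B →
      ∃ φ : Cfg → ℝ, Measurable φ ∧ (∃ C' : ℝ, ∀ U, |φ U| ≤ C') ∧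
        (∀ (g : Site 3 1 → SU2) (U : Cfg), φ (gaugeTransform g U) = φ U) ∧
        (∀ U, φ U ≠ 0 → (∀ e : Edge 3 1, 0 < scalarPart (U e)) ∧ orbitDist U < Real.sqrt (bareLambda B)) ∧
        0 < l2 φ φ ∧
        linkC B ^ 3 * Real.exp (-(physLevel 1 * bareLambda B) - C * bareLambda B ^ 2) * l2 φ φ ≤ qform su2Rep B φ φ ∧
        ∫ U, ‖zmCoord 1 U‖ ^ 2 * φ U ^ 2 ∂(configMeasure SU2 1) ≤ C * bareLambda B ^ 2 * l2 φ φ := by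
  -- AL1 data at `k = 0`
  obtain ⟨f, hsmooth, hinv, -, -, hdec, A, hA0, hq⟩ := (LuscherHamiltonianEigenfunctions_holds 0).quasimodes
  obtain ⟨Cf, -, hCf⟩ := exists_uniform_decay hdec
  have hE0 : 0 ≤ physLevel 1 := physLevel_nonneg le_rfl
  have hJ0 : 0 ≤ ∫ y : ZM, Real.exp (-‖y‖) := integral_nonneg fun y => (Real.exp_pos _).le
  have hMom1 : ((0:ℕ) + 1) * Cf ^ 2 * ∫ y : ZM, Real.exp (-‖y‖) = Cf ^ 2 * ∫ y : ZM, Real.exp (-‖y‖) := by push_cast; ring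
  have hMom0 : 0 ≤ Cf ^ 2 * ∫ y : ZM, Real.exp (-‖y‖) := by positivity
  have hK0 : 0 ≤ absLowerK (physLevel 1) A (Cf ^ 2 * ∫ y : ZM, Real.exp (-‖y‖)) 0 := absLowerK_nonneg hE0 hA0 hMom0 0
  generalize hE : physLevel 1 = E at hE0 hK0
  have hE1 : physLevel (0 + 1) = E := hE
  generalize hMom : Cf ^ 2 * ∫ y : ZM, Real.exp (-‖y‖) = Mom at hMom0 hK0 hMom1
  generalize hK : absLowerK E A Mom 0 = K at hK0
  -- the tail threshold `x⁶e^{−x} ≤ 3/16384`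
  obtain ⟨x₀, hx₀⟩ := exists_pow_mul_exp_neg_le (c := 1) one_pos (by norm_num : (0:ℝ) < 3 / 16384) 6
  -- the cross-copy threshold at `L = 1`, `m = 1/2`
  have hC₀0 : 0 ≤ (K + 2 * (2 * E + K) ^ 2) / 4 := by positivity
  generalize hC₀ : (K + 2 * (2 * E + K) ^ 2) / 4 = C₀ at hC₀0
  have huFC := uniformFloorConst_pos (L := 1)
  have hε₁ : 0 < 2 * Real.exp (-(E + C₀)) / uniformFloorConst 1 := by positivity
  obtain ⟨βc, hβc⟩ := crossBound_eventually_small_sq (L := 1) (m := 1 / 2) (by norm_num) hε₁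
  -- the chart-scale threshold `μ ≤ μ0`
  have hth1 : 0 < (1 / (2 * (A * ((0:ℕ) + 1) * 3072 + 1))) := by positivity
  have hth2 : 0 < 1 / (4 * π) := by positivity
  obtain ⟨μ0, hμ0pos, hμ0a, hμ0b, hμ0c, hμ0d, hμ0e⟩ : ∃ μ0 : ℝ, 0 < μ0 ∧ μ0 ≤ 1 / 256 ∧
      μ0 ≤ (1 / (2 * (A * ((0:ℕ) + 1) * 3072 + 1))) ^ ((1:ℝ) / 3) ∧ μ0 ≤ (1 / (4 * π)) ^ ((1:ℝ) / 3) ∧ μ0 ≤ 1 / (4 * (2 * E + K + 1)) ∧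
      μ0 ≤ (1 / (16 * max x₀ 1)) ^ 2 := by
    refine ⟨min (1 / 256) (min ((1 / (2 * (A * ((0:ℕ) + 1) * 3072 + 1))) ^ ((1:ℝ) / 3)) (min ((1 / (4 * π)) ^ ((1:ℝ) / 3))
      (min (1 / (4 * (2 * E + K + 1))) ((1 / (16 * max x₀ 1)) ^ 2)))), ?_, min_le_left _ _,
      (min_le_right _ _).trans (min_le_left _ _),
      (min_le_right _ _).trans ((min_le_right _ _).trans (min_le_left _ _)),
      (min_le_right _ _).trans ((min_le_right _ _).trans ((min_le_right _ _).trans (min_le_left _ _))),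
      (min_le_right _ _).trans ((min_le_right _ _).trans ((min_le_right _ _).trans (min_le_right _ _)))⟩
    have hX1 : 0 < max x₀ 1 := lt_of_lt_of_le one_pos (le_max_right _ _)
    exact lt_min (by norm_num) (lt_min (Real.rpow_pos_of_pos hth1 _) (lt_min (Real.rpow_pos_of_pos hth2 _)
      (lt_min (by positivity) (by positivity))))
  -- the constants of the statement
  refine ⟨max (C₀ + 1) (2 * Mom), max (2 / (2 * μ0) ^ 3) (max βc 2), le_max_of_le_left (by linarith), fun B hBge => ?_⟩
  have hCC₀ : C₀ + 1 ≤ max (C₀ + 1) (2 * Mom) := le_max_left _ _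
  have hCMom : 2 * Mom ≤ max (C₀ + 1) (2 * Mom) := le_max_right _ _
  generalize hCdef : max (C₀ + 1) (2 * Mom) = C at hCC₀ hCMom ⊢
  have hBge1 : 2 / (2 * μ0) ^ 3 ≤ B := (le_max_left _ _).trans hBge
  have hBc : βc ≤ B := ((le_max_left _ _).trans (le_max_right _ _)).trans hBge
  have hB2 : 2 ≤ B := ((le_max_right _ _).trans (le_max_right _ _)).trans hBge
  have hB : 0 < B := by linarith
  obtain ⟨μ, hμdef, hμ, hμle, hBμ, hμ256, hεμ, hBπ, ht, hsμ, hlam1, hlam0⟩ :=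
    scale_facts hA0 hE0 hK0 hμ0pos hμ0a hμ0b hμ0c hμ0d hμ0e hBge1 hB2
  have hμ8 : μ ≤ 1 / 8 := by linarith
  have hμ1 : μ ≤ 1 := by linarith
  -- the cut-off radius `R = 1/(16√μ)`
  obtain ⟨hR1, hRμ, hμR⟩ := cutoff_facts hμ hμ256
  have heR := exp_neg_cutoff_le hx₀ hμ hsμ
  have hμR' : μ * (1 / (16 * Real.sqrt μ)) ≤ 1 / 16 := by
    rw [hμR]
    have : Real.sqrt μ ≤ 1 := by
      rw [show (1:ℝ) = Real.sqrt 1 by rw [Real.sqrt_one]]; exact Real.sqrt_le_sqrt hμ1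
    linarith
  set R : ℝ := 1 / (16 * Real.sqrt μ) with hRdef
  have hR0 : 0 < R := lt_of_lt_of_le one_pos hR1
  -- the trial function and its one-copy restriction
  have hGti := isTestFn_isGaugeInv_radialCutoff_mul_span hR0 hsmooth hinv (fun _ : Fin (0 + 1) => (1:ℝ))
  have hGeq : (radialCutoff R * fun x => ∑ j, (fun _ : Fin (0 + 1) => (1:ℝ)) j * f j x) = cutSpan f R (fun _ => 1) := rfl
  rw [hGeq] at hGti
  obtain ⟨hGtest, hGinv⟩ := hGti
  have hGm : Measurable (cutSpan f R (fun _ => 1)) := hGtest.continuous.measurable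
  obtain ⟨CG, _, hCG⟩ := GaussForm.exists_bound_of_hasCompactSupport hGtest.continuous hGtest.2
  have hGb : ∃ C : ℝ, ∀ x, |cutSpan f R (fun _ => 1) x| ≤ C := ⟨CG, hCG⟩
  have hsupp : ∀ y, cutSpan f R (fun _ => 1) y ≠ 0 → ‖y‖ ≤ Real.sqrt 2 * R := fun y hy => norm_le_of_cutSpan_ne_zero f hR0 _ hy
  obtain ⟨hφm, hφb, hφg, hφsupp⟩ := one_copy_props hGm hGb hGinv μ
  set φ := Set.indicator {V : Cfg | ∀ e : Edge 3 1, 0 < scalarPart (V e)} (fun U : Cfg => cutSpan f R (fun _ => 1) (gnCoord μ U)) with hφ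
  -- the core estimates
  have ht0 : 0 ≤ 1 - 2 * μ * physLevel (0 + 1) - μ ^ 2 * absLowerK (physLevel (0 + 1)) A (((0:ℕ) + 1) * Cf ^ 2 * ∫ y : ZM, Real.exp (-‖y‖)) 0 := by
    rw [hE1, hMom1, hK]; linarith
  have hray := core_rayleigh hsmooth hinv hCf hA0 hq hB hμ hBμ hμ8 hεμ hBπ hR1 hRμ heR hμR' ht0
  obtain ⟨hnlo, hmom⟩ := core_norm_moment hsmooth hinv hCf hA0 hq hμ hεμ hR1 heR hμR'
  rw [hE1, hMom1, hK] at hray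
  rw [hMom] at hmom
  rw [← hφ] at hray hnlo hmom
  have hc0 : 0 < μ ^ 9 * ((2 * π ^ 2)⁻¹) ^ 3 := by positivity
  have hnpos : 0 < l2 φ φ := lt_of_lt_of_le (by positivity) hnlo
  refine ⟨φ, hφm, hφb, hφg, fun U hU => ?_, hnpos, ?_, ?_⟩
  · -- support: all-upper and `orbitDist < √λ_b`
    obtain ⟨hup, hG0⟩ := hφsupp U hU
    refine ⟨hup, ?_⟩
    have h := orbitDist_le_of_upper hμ hup (hsupp _ hG0)
    have h2 := support_radius_lt hμ hμR
    rw [hμdef]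
    linarith
  · -- the rate-grade Rayleigh bound
    have hexp : Real.exp (-(E * bareLambda B) - C₀ * bareLambda B ^ 2) ≤ 1 - (2 * μ * E + μ ^ 2 * K) := by
      rw [hμdef, ← hC₀]
      have := exp_le_one_sub hμ hμ1 hE0 hK0 ht
      linarith [this]
    -- the cross-copy terms: `7 cB ≤ ½ e^{−E−C₀} λ_b² linkC³ ≤ ½ e^{−Eλ_b−C₀λ_b²} λ_b² linkC³`
    have hcb := hβc B hBc
    rw [show ((1 : ℕ) : ℝ) ^ 3 * B = B by simp, latCE_one] at hcb
    have hlinkC0 : 0 < linkC B ^ 3 := pow_pos (linkC_pos hB.le) 3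
    have hlamsq1 : bareLambda B ^ 2 ≤ 1 := pow_le_one₀ hlam0.le hlam1
    have hea : Real.exp (-(E + C₀)) ≤ Real.exp (-(E * bareLambda B) - C₀ * bareLambda B ^ 2) := by
      apply Real.exp_le_exp.2
      have h1 : E * bareLambda B ≤ E := mul_le_of_le_one_right hE0 hlam1
      have h2 : C₀ * bareLambda B ^ 2 ≤ C₀ := mul_le_of_le_one_right hC₀0 hlamsq1
      linarith
    have hcb' : 7 * crossBound 1 B (1 / 2) ≤ (1 / 2) * Real.exp (-(E * bareLambda B) - C₀ * bareLambda B ^ 2) * bareLambda B ^ 2 * linkC B ^ 3 := by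
      have e1 : 2 * Real.exp (-(E + C₀)) / uniformFloorConst 1 * bareLambda B ^ 2 * (uniformFloorConst 1 * linkC B ^ 3) =
          2 * Real.exp (-(E + C₀)) * bareLambda B ^ 2 * linkC B ^ 3 := by field_simp
      rw [e1] at hcb
      have h3 : 2 * Real.exp (-(E + C₀)) * bareLambda B ^ 2 * linkC B ^ 3 ≤
          2 * Real.exp (-(E * bareLambda B) - C₀ * bareLambda B ^ 2) * bareLambda B ^ 2 * linkC B ^ 3 :=
        mul_le_mul_of_nonneg_right (mul_le_mul_of_nonneg_right (by linarith) (sq_nonneg _)) hlinkC0.le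
      linarith
    -- `1 − λ_b²/2 ≥ e^{−λ_b²}` and `e^{−Eλ−Cλ²} ≤ e^{−Eλ−C₀λ²}·e^{−λ²}`
    have hl2sq : bareLambda B ^ 2 ≤ 1 / 2 := by
      have h1 : bareLambda B ^ 2 ≤ bareLambda B := by rw [sq]; exact mul_le_of_le_one_left hlam0.le hlam1
      have h2 : bareLambda B ≤ 1 / 128 := by rw [hμdef]; linarith
      linarith
    have hhalf := exp_neg_le_one_sub_half (sq_nonneg (bareLambda B)) hl2sq
    have hCexp : Real.exp (-(E * bareLambda B) - C * bareLambda B ^ 2) ≤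
        Real.exp (-(E * bareLambda B) - C₀ * bareLambda B ^ 2) * Real.exp (-(bareLambda B ^ 2)) := by
      rw [← Real.exp_add]
      apply Real.exp_le_exp.2
      have := mul_le_mul_of_nonneg_right hCC₀ (sq_nonneg (bareLambda B))
      linarith
    have hray' : linkC B ^ 3 * (1 - (2 * μ * E + μ ^ 2 * K)) * l2 φ φ ≤ qform su2Rep B φ φ + 7 * crossBound 1 B (1 / 2) * l2 φ φ := by
      rw [show (1 - (2 * μ * E + μ ^ 2 * K)) = 1 - 2 * μ * E - μ ^ 2 * K by ring]; exact hray
    exact rayleigh_algebra (t := 2 * μ * E + μ ^ 2 * K) hlinkC0.le hnpos.le (Real.exp_pos _).le hray' hexp hcb' hhalf hCexp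
  · -- the second moment: `5μ²·Mom = (5/4)λ_b²·Mom ≤ C λ_b²`
    refine hmom.trans ?_
    have hμ2 : μ ^ 2 = bareLambda B ^ 2 / 4 := by rw [hμdef]; ring
    rw [hμ2]
    have hx : 0 ≤ Mom * bareLambda B ^ 2 := mul_nonneg hMom0 (sq_nonneg _)
    have hC2 := mul_le_mul_of_nonneg_right hCMom (sq_nonneg (bareLambda B))
    have : 5 * (bareLambda B ^ 2 / 4) * Mom ≤ C * bareLambda B ^ 2 := by
      rw [show 5 * (bareLambda B ^ 2 / 4) * Mom = (5 / 4) * (Mom * bareLambda B ^ 2) by ring]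
      rw [show 2 * Mom * bareLambda B ^ 2 = 2 * (Mom * bareLambda B ^ 2) by ring] at hC2
      linarith
    exact mul_le_mul_of_nonneg_right this hnpos.le

/-- ★★ **The same quasimode against the one-site ground level `μ₀(B)`**: eventually in `B`, `e^{−Cλ_b²}·μ₀(B)·‖φ‖² ≤ ⟨φ, K_B φ⟩` (crux ONE's absolute upper bound
`μ₀ ≤ linkC³e^{−E₁λ_b + C_up λ_b²}`, `oneSiteAbsUpper_holds 0`), with the same support, invariance and concentration `∫‖zmCoord 1‖²φ² ≤ Cλ_b²‖φ‖²`.  This is the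
one-site input of the FLOOR WITH RATE of the Born–Oppenheimer door with rate (`stub_boRate`). [cite: Luscher1983, §2] [cite: ReedSimonIV1978, Thm. XIII.1–2] -/
theorem exists_concentrated_quasimode_levelValue :
    ∃ C B₀ : ℝ, 0 ≤ C ∧ ∀ B : ℝ, B₀ ≤ B →
      ∃ φ : Cfg → ℝ, Measurable φ ∧ (∃ C' : ℝ, ∀ U, |φ U| ≤ C') ∧
        (∀ (g : Site 3 1 → SU2) (U : Cfg), φ (gaugeTransform g U) = φ U) ∧
        (∀ U, φ U ≠ 0 → (∀ e : Edge 3 1, 0 < scalarPart (U e)) ∧ orbitDist U < Real.sqrt (bareLambda B)) ∧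
        0 < l2 φ φ ∧
        Real.exp (-(C * bareLambda B ^ 2)) * levelValue su2Rep 1 B 0 * l2 φ φ ≤ qform su2Rep B φ φ ∧
        ∫ U, ‖zmCoord 1 U‖ ^ 2 * φ U ^ 2 ∂(configMeasure SU2 1) ≤ C * bareLambda B ^ 2 * l2 φ φ := by
  obtain ⟨C, B₀, hC0, h⟩ := exists_concentrated_quasimode
  obtain ⟨Cu, Bu, hu⟩ := PScal.oneSiteAbsUpper_holds 0
  refine ⟨C + |Cu|, max (max B₀ Bu) 0, by positivity, fun B hB => ?_⟩
  obtain ⟨φ, hm, hb, hg, hs, hpos, hq, hmom⟩ := h B (((le_max_left _ _).trans (le_max_left _ _)).trans hB)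
  have hup := hu B (((le_max_right _ _).trans (le_max_left _ _)).trans hB)
  have hB0 : 0 ≤ B := (le_max_right _ _).trans hB
  refine ⟨φ, hm, hb, hg, hs, hpos, ?_, hmom.trans (mul_le_mul_of_nonneg_right (mul_le_mul_of_nonneg_right (by linarith [abs_nonneg Cu])
    (sq_nonneg _)) hpos.le)⟩
  have hE1 : physLevel (0 + 1) = physLevel 1 := rfl
  rw [hE1] at hup
  -- `e^{−(C+|Cu|)λ²} μ₀ ≤ e^{−(C+|Cu|)λ²} linkC³ e^{−E₁λ + Cu λ²} ≤ linkC³ e^{−E₁λ − Cλ²}`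
  have h1 : Real.exp (-((C + |Cu|) * bareLambda B ^ 2)) * levelValue su2Rep 1 B 0 ≤
      Real.exp (-((C + |Cu|) * bareLambda B ^ 2)) * (linkC B ^ 3 * Real.exp (-(physLevel 1 * bareLambda B) + Cu * bareLambda B ^ 2)) :=
    mul_le_mul_of_nonneg_left hup (Real.exp_pos _).le
  have h2 : Real.exp (-((C + |Cu|) * bareLambda B ^ 2)) * (linkC B ^ 3 * Real.exp (-(physLevel 1 * bareLambda B) + Cu * bareLambda B ^ 2)) ≤
      linkC B ^ 3 * Real.exp (-(physLevel 1 * bareLambda B) - C * bareLambda B ^ 2) := by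
    rw [show Real.exp (-((C + |Cu|) * bareLambda B ^ 2)) * (linkC B ^ 3 * Real.exp (-(physLevel 1 * bareLambda B) + Cu * bareLambda B ^ 2)) =
      linkC B ^ 3 * (Real.exp (-((C + |Cu|) * bareLambda B ^ 2)) * Real.exp (-(physLevel 1 * bareLambda B) + Cu * bareLambda B ^ 2)) by ring,
      ← Real.exp_add]
    refine mul_le_mul_of_nonneg_left (Real.exp_le_exp.2 ?_) (pow_nonneg (linkC_pos hB0).le 3)
    nlinarith [le_abs_self Cu, sq_nonneg (bareLambda B)]
  exact le_trans (mul_le_mul_of_nonneg_right (h1.trans h2) hpos.le) hq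

end Quasimode

end Summit.QuantumFields.YangMills.Theorems.FemtoTransferGap

end
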